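import Summits.BirchSwinnertonDyer.BirchSwinnertonDyer.Theorems.ClassRecordThreeEulerHalvesAtThreeCartanCoverPeriodLattice
import Literature.NumberTheory.Automorphic.HyperbolicLaplaceSpectrum
import HarnessLib

/-!
# Crux NUM `CartanOnePlaceDegreeLawAtThree` (item 24801) — (GRAM) inputs: component-summed Petersson
# norms on `ℂ[G]·u` (finiteness propagates, `indRep`-invariance)

Seat `bsd-stepL-tam3-p1` g30 (LEAD of 24801; `--supports` 24801). For the last open content stub
`(GRAM)` `PeterssonGram` of the `petarea` cut of (PET) (`Cruxes/…/Lines/petarea.lean`), whose hypothesis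
only bounds the component Petersson norms of `u` itself:

* `petSum_indRep` : the component-summed Petersson norm `Σ_{g ∈ GL₂(𝔽_q)} ∫⁻_{Fq} ‖v_g τ‖² (Im τ)² dμ` is
  `indRep`-invariant (re-indexing `g ↦ g g'`);
* `setLIntegral_pet_lt_top_of_mem_spanG` — if every component of `u` has finite norm over `Fq`, so does
  every component of every `v ∈ ℂ[G]·u` (span induction; `‖a + b‖² ≤ 2‖a‖² + 2‖b‖²`), hence
  `petSum_lt_top_of_mem_spanG` ∕ `_of_mem_periodLattice` : the component sum is finite.

Nothing about NUM or any curve; BSD is proved for no curve. [cite: ShimuraIATAF1971, §2.1 and §3.5] [cite: Iwaniec2002, §2.3]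
-/

set_option linter.dupNamespace false
set_option autoImplicit false

noncomputable section

open scoped Classical Pointwise MatrixGroups ModularForm ENNReal UpperHalfPlane
open MeasureTheory

namespace Summit.BirchSwinnertonDyer.BirchSwinnertonDyer.Theorems.CartanCover

open Literature.NumberTheory.Automorphic Literature.NumberTheory.EllipticCurves.ModularForms

variable {D M : ℕ} {C : Finset ℕ} {X : CartanLevelCurveData D M C} {q : ℕ}

namespace CoverReduction

variable [Fact q.Prime] (R : CoverReduction X q)

/-- **`indRep`-invariance of the component-summed Petersson norm**:
`Σ_g ∫⁻_{Fq} ‖(g'·v)_g‖² y² = Σ_g ∫⁻_{Fq} ‖v_g‖² y²` (the components are permuted by `g ↦ g g'`). -/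
theorem petSum_indRep (Fq : Set ℍ) (g' : GL (Fin 2) (ZMod q)) (v : R.IndCuspForm) :
    ∑ g : GL (Fin 2) (ZMod q), ∫⁻ τ in Fq, ENNReal.ofReal (‖((R.indRep g' v).1 g) τ‖ ^ 2 * τ.im ^ 2) =
      ∑ g : GL (Fin 2) (ZMod q), ∫⁻ τ in Fq, ENNReal.ofReal (‖(v.1 g) τ‖ ^ 2 * τ.im ^ 2) := by
  simp_rw [R.indRep_apply]
  exact Fintype.sum_equiv (Equiv.mulRight g') _ _ (fun g => rfl)

/-- The pointwise bound `‖a + b‖² y² ≤ 2 (‖a‖² y²) + 2 (‖b‖² y²)` in `ℝ≥0∞`. -/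
theorem ofReal_norm_add_sq_mul_le (a b : ℂ) (y : ℝ) :
    ENNReal.ofReal (‖a + b‖ ^ 2 * y ^ 2) ≤
      2 * ENNReal.ofReal (‖a‖ ^ 2 * y ^ 2) + 2 * ENNReal.ofReal (‖b‖ ^ 2 * y ^ 2) := by
  have h1 : ‖a + b‖ ^ 2 ≤ 2 * ‖a‖ ^ 2 + 2 * ‖b‖ ^ 2 := by
    have h := norm_add_le a b
    nlinarith [norm_nonneg a, norm_nonneg b, norm_nonneg (a + b), sq_nonneg (‖a‖ - ‖b‖)]
  have hy : 0 ≤ y ^ 2 := sq_nonneg y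
  calc ENNReal.ofReal (‖a + b‖ ^ 2 * y ^ 2)
      ≤ ENNReal.ofReal ((2 * ‖a‖ ^ 2 + 2 * ‖b‖ ^ 2) * y ^ 2) :=
        ENNReal.ofReal_le_ofReal (mul_le_mul_of_nonneg_right h1 hy)
    _ = 2 * ENNReal.ofReal (‖a‖ ^ 2 * y ^ 2) + 2 * ENNReal.ofReal (‖b‖ ^ 2 * y ^ 2) := by
        rw [show (2 * ‖a‖ ^ 2 + 2 * ‖b‖ ^ 2) * y ^ 2 = 2 * (‖a‖ ^ 2 * y ^ 2) + 2 * (‖b‖ ^ 2 * y ^ 2) by ring,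
          ENNReal.ofReal_add (by positivity) (by positivity), ENNReal.ofReal_mul (by norm_num),
          ENNReal.ofReal_mul (by norm_num)]
        simp

/-- **Finiteness propagates along `ℂ[G]·u`**: if every component of `u` has finite Petersson norm over `Fq`,
so does every component of every `v ∈ ℂ[G]·u`. -/
theorem setLIntegral_pet_lt_top_of_mem_spanG {Fq : Set ℍ} (u : R.IndCuspForm)
    (hu : ∀ g : GL (Fin 2) (ZMod q), ∫⁻ τ in Fq, ENNReal.ofReal (‖(u.1 g) τ‖ ^ 2 * τ.im ^ 2) < ⊤)
    {v : R.IndCuspForm} (hv : v ∈ R.spanG u) :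
    ∀ g : GL (Fin 2) (ZMod q), ∫⁻ τ in Fq, ENNReal.ofReal (‖(v.1 g) τ‖ ^ 2 * τ.im ^ 2) < ⊤ := by
  unfold spanG at hv
  refine Submodule.span_induction
    (p := fun v _ => ∀ g : GL (Fin 2) (ZMod q), ∫⁻ τ in Fq, ENNReal.ofReal (‖(v.1 g) τ‖ ^ 2 * τ.im ^ 2) < ⊤)
    ?_ ?_ ?_ ?_ hv
  · rintro _ ⟨g', rfl⟩ g
    rw [R.indRep_apply]
    exact hu (g * g')
  · intro g
    simp
  · intro x y _ _ hx hy g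
    have hle : ∫⁻ τ in Fq, ENNReal.ofReal (‖((x + y).1 g) τ‖ ^ 2 * τ.im ^ 2) ≤
        ∫⁻ τ in Fq, (2 * ENNReal.ofReal (‖(x.1 g) τ‖ ^ 2 * τ.im ^ 2) + 2 * ENNReal.ofReal (‖(y.1 g) τ‖ ^ 2 * τ.im ^ 2)) := by
      refine lintegral_mono fun τ => ?_
      have e : ((x + y).1 g) τ = (x.1 g) τ + (y.1 g) τ := by
        change ((x.1 + y.1) g) τ = _
        rw [Pi.add_apply, CuspForm.add_apply]
      rw [e]
      exact ofReal_norm_add_sq_mul_le _ _ _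
    refine lt_of_le_of_lt hle ?_
    have hmx : Measurable fun τ : ℍ => ENNReal.ofReal (‖(x.1 g) τ‖ ^ 2 * τ.im ^ 2) :=
      ENNReal.measurable_ofReal.comp
        (((continuous_norm.comp (x.1 g).holo'.continuous).pow 2).mul (UpperHalfPlane.continuous_im.pow 2)).measurable
    rw [lintegral_add_left' ((hmx.const_mul 2).aemeasurable), lintegral_const_mul' _ _ (by norm_num),
      lintegral_const_mul' _ _ (by norm_num)]
    exact ENNReal.add_lt_top.mpr ⟨ENNReal.mul_lt_top (by simp) (hx g), ENNReal.mul_lt_top (by simp) (hy g)⟩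
  · intro c x _ hx g
    have e : ∀ τ, ((c • x).1 g) τ = c * (x.1 g) τ := by
      intro τ
      change ((c • x.1) g) τ = _
      rw [Pi.smul_apply, CuspForm.IsGLPos.smul_apply, smul_eq_mul]
    simp_rw [e, norm_mul, mul_pow, mul_assoc]
    simp_rw [ENNReal.ofReal_mul (sq_nonneg ‖c‖)]
    rw [lintegral_const_mul' _ _ ENNReal.ofReal_ne_top]
    exact ENNReal.mul_lt_top ENNReal.ofReal_lt_top (hx g)

/-- Hence **`Σ_g ∫⁻_{Fq} ‖v_g‖² y² < ⊤` for every `v ∈ ℂ[G]·u`** under the (GRAM) finiteness hypothesis on `u`. -/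
theorem petSum_lt_top_of_mem_spanG {Fq : Set ℍ} (u : R.IndCuspForm)
    (hu : ∀ g : GL (Fin 2) (ZMod q), ∫⁻ τ in Fq, ENNReal.ofReal (‖(u.1 g) τ‖ ^ 2 * τ.im ^ 2) < ⊤)
    {v : R.IndCuspForm} (hv : v ∈ R.spanG u) :
    ∑ g : GL (Fin 2) (ZMod q), ∫⁻ τ in Fq, ENNReal.ofReal (‖(v.1 g) τ‖ ^ 2 * τ.im ^ 2) < ⊤ :=
  ENNReal.sum_lt_top.mpr fun g _ => R.setLIntegral_pet_lt_top_of_mem_spanG u hu hv g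

/-- In particular for the elements of the period lattice `𝕃(u, Λ) ⊆ ℂ[G]·u`. -/
theorem petSum_lt_top_of_mem_periodLattice {Fq : Set ℍ} (Λ : Submodule ℤ ℂ) (u : R.IndCuspForm)
    (hu : ∀ g : GL (Fin 2) (ZMod q), ∫⁻ τ in Fq, ENNReal.ofReal (‖(u.1 g) τ‖ ^ 2 * τ.im ^ 2) < ⊤)
    (v : R.periodLattice Λ u) :
    ∑ g : GL (Fin 2) (ZMod q), ∫⁻ τ in Fq, ENNReal.ofReal (‖((v : R.IndCuspForm).1 g) τ‖ ^ 2 * τ.im ^ 2) < ⊤ :=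
  R.petSum_lt_top_of_mem_spanG u hu ((R.mem_periodLattice_iff Λ u v).mp v.2).1

end CoverReduction

end Summit.BirchSwinnertonDyer.BirchSwinnertonDyer.Theorems.CartanCover

end
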